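import Literature.Barriers.BirchSwinnertonDyer.DescentDefectUnboundedMatsunoCor33Proofs
import HarnessLib

/-!
# `H¹(K, E[p^M]) → H¹(K, E[p^∞])`: the level-`p^M` comparison, Selmer to Selmer, injective when
# `E(K̄)[p^∞]` has no non-zero `Γ_K`-fixed point

File `SelmerCorankAssembly` constructs `torsionToPrimaryH1 : H¹(K, E[p]) → H¹(K, E[p^∞])` (level
`p`); `Barriers/…/DescentDefectUnboundedMatsunoCor33Proofs` has the level-`p^e` map existentially
(`exists_torsionToPrimaryHom`, with the surjection onto `H¹(K, E[p^∞])[p^e]`) and the inclusion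
`geomTorsion_pow_le_geomPrimaryTorsion`, reused here. Finite-level arguments at level `p^M` —
Kolyvagin's classes `c_M(n) ∈ H¹(K, E[p^M])`
(`KolyvaginHeegnerData.kolyvaginClass`), read inside `Sel_{p^∞}(E/K)` (Kolyvagin 1991, §2:
`H = lim H¹(K, E_M)`, `S = lim S(K, E_M)`; W. Zhang 2014, p. 248: "we will view
`c_M(n) ∈ H¹(K, E[p^M])` as an element of `H¹(K, E[p^∞])`") — need the same map at every level:

* `torsionPowToPrimaryH1 W p M : H¹(K, E[p^M]) →+ H¹(K, E[p^∞])` (induced by `E[p^M] ↪ E[p^∞]`);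
* `primaryH1ToH1_comp_torsionPowToPrimaryH1` — compatibility with `H¹(K, E[·]) → H¹(K, E)`;
* `pow_nsmul_torsionPowToPrimaryH1` — the image is killed by `p^M`;
* `torsionPowToPrimaryH1_mem_selmerGroupPInfty` — `Sel^{(p^M)}(E/K) → Sel_{p^∞}(E/K)` (both are
  preimages of `Ш(E/K)`);
* `torsionPowToPrimaryH1_injective` — injective as soon as `E(K̄)[p^∞]^{Γ_K} = 0` (the kernel is
  `E(K̄)[p^∞]^{Γ_K} / p^M`, from `0 → E[p^M] → E[p^∞] → E[p^∞] → 0`; Zhang 2014, p. 248: "Under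
  the irreducibility of `ρ_{E,p}` we have an injection `H¹(K, E[p^M]) ↪ H¹(K, E[p^{M+M'}])`").

Everything is proved; no named fact. [folklore] throughout (Greenberg, LNM 1716 (1999), §2;
Serre, *Galois Cohomology*, I.§2).
-/

noncomputable section

open scoped Classical AddSubgroup

universe u

namespace WeierstrassCurve

open Literature.NumberTheory.EllipticCurves Literature.NumberTheory.GaloisRepresentations
  Literature.Barriers.BirchSwinnertonDyer

variable {K : Type u} [Field K] (W : WeierstrassCurve K) (p M : ℕ)

/-- The map `H¹(K, E[p^M]) → H¹(K, E[p^∞])` induced by the inclusion `E[p^M] ↪ E[p^∞]`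
(Mathlib's `ContinuousCohomology.map` along `(id : Γ_K → Γ_K, E[p^M] ↪ E[p^∞])`, through the
tree's `resH1Hom`); level-`p^M` companion of `torsionToPrimaryH1`.
[cite: Greenberg1999, §2 (p. 62–63)] [cite: WZhang2014, p. 248] -/
def torsionPowToPrimaryH1 : galH1Torsion W ((p ^ M : ℕ) : ℤ) →+ galH1Primary W p :=
  resH1Hom (ContinuousMonoidHom.id (Field.absoluteGaloisGroup K))
    (AddSubgroup.inclusion (geomTorsion_pow_le_geomPrimaryTorsion W p M)) fun _ _ ↦ rfl

/-- `torsionPowToPrimaryH1` on an explicit class: `[φ] ↦ [E[p^M] ↪ E[p^∞] ∘ φ]`.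
[cite: SerreGaloisCohomology1997, I.§2.4] -/
theorem torsionPowToPrimaryH1_oneCocycleClass
    (φ : contOneCocycles (discreteTopRep (Field.absoluteGaloisGroup K)
      (geomTorsion W ((p ^ M : ℕ) : ℤ)))) :
    torsionPowToPrimaryH1 W p M (oneCocycleClass _ φ) =
      oneCocycleClass _ (contOneCocycles.push
        (AddSubgroup.inclusion (geomTorsion_pow_le_geomPrimaryTorsion W p M)) (fun _ _ ↦ rfl) φ) :=
  resH1Hom_id_oneCocycleClass _ _ φ

/-- **`H¹(K, E[p^M]) → H¹(K, E[p^∞]) → H¹(K, E)` is `H¹(K, E[p^M]) → H¹(K, E)`** (functoriality).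
[cite: SerreGaloisCohomology1997, I.§2.4] -/
theorem primaryH1ToH1_comp_torsionPowToPrimaryH1 :
    (primaryH1ToH1 W p).comp (torsionPowToPrimaryH1 W p M) = torsionH1ToH1 W ((p ^ M : ℕ) : ℤ) := by
  rw [primaryH1ToH1, torsionPowToPrimaryH1, resH1Hom_comp, torsionH1ToH1_eq_resH1Hom]
  exact resH1Hom_congr rfl (AddMonoidHom.ext fun _ ↦ rfl) _ _

/-- Pointwise form of `primaryH1ToH1_comp_torsionPowToPrimaryH1`.
[cite: SerreGaloisCohomology1997, I.§2.4] -/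
theorem primaryH1ToH1_torsionPowToPrimaryH1 (y : galH1Torsion W ((p ^ M : ℕ) : ℤ)) :
    primaryH1ToH1 W p (torsionPowToPrimaryH1 W p M y) = torsionH1ToH1 W ((p ^ M : ℕ) : ℤ) y := by
  rw [← primaryH1ToH1_comp_torsionPowToPrimaryH1]
  rfl

/-- **The image of `H¹(K, E[p^M])` in `H¹(K, E[p^∞])` is killed by `p^M`** (Zhang 2014, p. 248:
`H¹(K, E[p^M])` is viewed as the kernel of multiplication by `p^M` on `H¹(K, E[p^∞])`).
[cite: WZhang2014, p. 248] -/
theorem pow_nsmul_torsionPowToPrimaryH1 (y : galH1Torsion W ((p ^ M : ℕ) : ℤ)) :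
    p ^ M • torsionPowToPrimaryH1 W p M y = 0 := by
  obtain ⟨φ, rfl⟩ := oneCocycleClass_surjective _ y
  rw [← map_nsmul, nsmul_oneCocycleClass_eq_zero φ (p ^ M) (fun g ↦ AddSubgroup.torsionBy.nsmul _),
    map_zero]

section NumberField

variable [NumberField K]

/-- **`Sel^{(p^M)}(E/K) → Sel_{p^∞}(E/K)`**: the level-`p^M` Selmer group maps into the
`p^∞`-Selmer group, both being the preimages of `Ш(E/K)` (`selmerGroup_eq_comap_sha`,
`selmerGroupPInfty_eq_comap_sha`) under compatible maps (Greenberg 1999, §2, p. 63: the local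
conditions of `Sel_E(K)_p` are those of `Sel_E(K)` at finite level).
[cite: Greenberg1999, §2 (p. 63)] -/
theorem torsionPowToPrimaryH1_mem_selmerGroupPInfty {y : galH1Torsion W ((p ^ M : ℕ) : ℤ)}
    (hy : y ∈ selmerGroup W ((p ^ M : ℕ) : ℤ)) :
    torsionPowToPrimaryH1 W p M y ∈ selmerGroupPInfty W p := by
  rw [selmerGroupPInfty_eq_comap_sha, AddSubgroup.mem_comap, primaryH1ToH1_torsionPowToPrimaryH1]
  rw [selmerGroup_eq_comap_sha, AddSubgroup.mem_comap] at hy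
  exact hy

/-- The image of `Sel^{(p^M)}(E/K)` lies in `Sel_{p^∞}(E/K)`. [cite: Greenberg1999, §2 (p. 63)] -/
theorem map_torsionPowToPrimaryH1_selmerGroup_le :
    (selmerGroup W ((p ^ M : ℕ) : ℤ)).map (torsionPowToPrimaryH1 W p M) ≤ selmerGroupPInfty W p :=
  fun _ ⟨_, hy, hx⟩ ↦ hx ▸ torsionPowToPrimaryH1_mem_selmerGroupPInfty W p M hy

end NumberField

/-- **Injectivity**: if `E(K̄)[p^∞]` has no non-zero `Γ_K`-fixed point (e.g. `E(K)[p] = 0`),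
`H¹(K, E[p^M]) → H¹(K, E[p^∞])` is injective: a cocycle `φ` with values in `E[p^M]` which is
the coboundary of `a ∈ E[p^∞]` has `p^M a` fixed by `Γ_K`, so `p^M a = 0`, `a ∈ E[p^M]`, and
`φ` is already a coboundary in `E[p^M]` (Zhang 2014, p. 248: "Under the irreducibility of
`ρ_{E,p}`, we have an injection `H¹(K, E[p^M]) ↪ H¹(K, E[p^{M+M'}])`").
[cite: WZhang2014, p. 248] [cite: GrossLMS1991, §4 (proof of Prop. 4.1)] -/
theorem torsionPowToPrimaryH1_injective
    (hfix : ∀ a : geomPrimaryTorsion W p,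
      (∀ σ : Field.absoluteGaloisGroup K, σ • a = a) → a = 0) :
    Function.Injective (torsionPowToPrimaryH1 W p M) := by
  refine (injective_iff_map_eq_zero _).mpr fun y hy ↦ ?_
  obtain ⟨φ, rfl⟩ := oneCocycleClass_surjective _ y
  rw [torsionPowToPrimaryH1_oneCocycleClass] at hy
  obtain ⟨a, ha⟩ := (oneCocycleClass_eq_zero_iff _ _).mp hy
  -- `ha σ : ↑(φ σ) = σ • a - a` in `E[p^∞]`; on underlying points:
  have ha' : ∀ σ : Field.absoluteGaloisGroup K,
      ((φ.1 σ : geomTorsion W ((p ^ M : ℕ) : ℤ)) : geomPoints W) = σ • (a : geomPoints W) - a := by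
    intro σ
    have h := ha σ
    change AddSubgroup.inclusion (geomTorsion_pow_le_geomPrimaryTorsion W p M) (φ.1 σ) =
      σ • a - a at h
    have h' := congrArg (fun b : geomPrimaryTorsion W p ↦ (b : geomPoints W)) h
    simpa only [AddSubgroup.coe_inclusion, AddSubgroupClass.coe_sub,
      primaryComponent.coe_smul] using h'
  -- `p^M a` is `Γ_K`-fixed, hence zero
  have hpMa : p ^ M • (a : geomPoints W) = 0 := by
    have hfixed : ∀ σ : Field.absoluteGaloisGroup K, σ • (p ^ M • a) = p ^ M • a := by
      intro σ
      apply Subtype.ext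
      rw [primaryComponent.coe_smul, AddSubmonoidClass.coe_nsmul, smul_comm, ← sub_eq_zero,
        ← smul_sub, ← ha' σ, ← AddSubmonoidClass.coe_nsmul, AddSubgroup.torsionBy.nsmul,
        ZeroMemClass.coe_zero]
    have h0 := hfix _ hfixed
    have h1 := congrArg (fun b : geomPrimaryTorsion W p ↦ (b : geomPoints W)) h0
    simpa only [AddSubmonoidClass.coe_nsmul, ZeroMemClass.coe_zero] using h1
  -- so `a ∈ E[p^M]`, and `φ` is its coboundary there
  set a' : geomTorsion W ((p ^ M : ℕ) : ℤ) := ⟨(a : geomPoints W), AddSubgroup.torsionBy.nsmul_iff.mpr hpMa⟩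
    with ha'def
  refine (oneCocycleClass_eq_zero_iff _ φ).mpr ⟨a', fun σ ↦ Subtype.ext ?_⟩
  change ((φ.1 σ : geomTorsion W ((p ^ M : ℕ) : ℤ)) : geomPoints W) =
    (((σ • a' - a' : geomTorsion W ((p ^ M : ℕ) : ℤ))) : geomPoints W)
  rw [AddSubgroupClass.coe_sub, AddSubgroup.torsionBy.coe_smul, ha']

/-- **No `p`-torsion over `K` ⇒ no `Γ_K`-fixed point in `E(K̄)[p^∞]`** (`K` perfect): a fixed
`a ∈ E(K̄)[p^∞]` descends to `P ∈ E(K)` (`exists_toGeomPoints_eq_of_forall_smul_eq`) with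
`p^k P = 0`, and `E(K)[p] = 0` forces `P = 0` by induction on `k`.
[cite: GrossLMS1991, §4 (Lemma 4.3, no p-torsion)] -/
theorem geomPrimaryTorsion_eq_zero_of_forall_smul_eq [PerfectField K]
    (hK : AddSubgroup.torsionBy W.toAffine.Point (p : ℤ) = ⊥)
    (a : geomPrimaryTorsion W p) (ha : ∀ σ : Field.absoluteGaloisGroup K, σ • a = a) : a = 0 := by
  have hfixQ : ∀ σ : Field.absoluteGaloisGroup K, σ • (a : geomPoints W) = a := fun σ ↦ by
    rw [← primaryComponent.coe_smul, ha σ]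
  obtain ⟨P, hP⟩ := exists_toGeomPoints_eq_of_forall_smul_eq W hfixQ
  obtain ⟨k, hk⟩ := AddCommGroup.mem_primaryComponent.mp a.2
  -- `p^k • P = 0` in `E(K)`
  have hkP : p ^ k • P = 0 := toGeomPoints_injective W (by rw [map_nsmul, hP, map_zero]; exact hk)
  -- `E(K)[p] = 0` kills all `p`-power torsion
  have hzero : ∀ (j : ℕ) (Q : W.toAffine.Point), p ^ j • Q = 0 → Q = 0 := by
    intro j
    induction j with
    | zero => intro Q hQ; simpa using hQ
    | succ j ih =>
      intro Q hQ
      apply ih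
      have hmem : p ^ j • Q ∈ AddSubgroup.torsionBy W.toAffine.Point (p : ℤ) :=
        AddSubgroup.torsionBy.nsmul_iff.mpr (by rw [smul_smul, ← pow_succ', hQ])
      rw [hK] at hmem
      exact (AddSubgroup.mem_bot).mp hmem
  have hP0 : P = 0 := hzero k P hkP
  apply Subtype.ext
  rw [ZeroMemClass.coe_zero, ← hP, hP0, map_zero]

/-- **Injectivity of `H¹(K, E[p^M]) → H¹(K, E[p^∞])` when `E(K)[p] = 0`** (`K` perfect).
[cite: WZhang2014, p. 248] [cite: GrossLMS1991, §4] -/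
theorem torsionPowToPrimaryH1_injective_of_torsionBy_eq_bot [PerfectField K]
    (hK : AddSubgroup.torsionBy W.toAffine.Point (p : ℤ) = ⊥) :
    Function.Injective (torsionPowToPrimaryH1 W p M) :=
  torsionPowToPrimaryH1_injective W p M (geomPrimaryTorsion_eq_zero_of_forall_smul_eq W p hK)

end WeierstrassCurve
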